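import Literature.Computability.Complexity.GateEliminationStanding
import Literature.Computability.Complexity.GateEliminationRegate

/-!
# Gate elimination: the five-rule normalization lemma

The theorem-content of the notion `Semicircuit.Normalized` (Li–Yang, STOC 2022, §3.3: "A circuit
is called normalized if no normalization rule can apply to it"; Lemma 3.11 (Normalization lemma):
"For Rule 1 we have `Δμ ≥ 1 − 2α_φ`, and for other rules we have `Δμ ≥ 1 − α_φ`"; and the remark
closing §3.3: "Note that `α_φ` will be chosen to be smaller than `1/2`, so that `Δμ ≥ 0`. Since
normalization will decrease the complexity measure, it will not bother us to assume that the
circuit is normalized during gate elimination procedure" — Case 0 of the proof of Thm. 4.1):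

* `Semicircuit.simplify_of_useless` — in a pre-normalized fair semicircuit computing `f|_R`
  (`f` an affine disperser for dimension `d`, `dim R ≥ 2d + 1`) with a packing, a useless gate is
  eliminated by Rule 4 (`rule4`; it is never the output, `out_ne_gate_of_useless`): one gate
  fewer, `Δμ ≥ 1 − 2α_φ`;
* `Semicircuit.exists_normalized` — for `0 ≤ α_φ ≤ 1/2`, `0 ≤ α_I`, every fair semicircuit
  computing `f|_R` (`dim R ≥ 2d + 2`) with a packing can be replaced by a **normalized** one (all
  five rules: `PreNormalized` and no useless gate) that is fair, computes `f|_R`, carries a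
  packing, has no more gates and no larger measure. This extends `exists_preNormalized`
  (Rules 1, 2/3, 5) by Rule 4.

Everything is PROVED (no named facts).

## References

* J. Li, T. Yang, *3.1n − o(n) circuit lower bounds for explicit functions*, STOC 2022
  [LiYang2022], §3.3 (Rules 1–5, "normalized"), Lemma 3.11, §4 (proof sketch of Thm. 4.1, Case 0);
  full version ECCC TR21-023, §3.3, §4.1 (Case 0.1).
-/

namespace Literature.Computability.Complexity

open Finset

namespace Semicircuit

variable {n : ℕ} {C : Semicircuit n} {f : (Fin n → ZMod 2) → Bool} {R : RdqSource n} {d : ℕ}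
  {αφ αI : ℝ} {P : Finset (Fin C.m × Fin C.m)}

/-- **Rule 4 applies to any useless gate of a pre-normalized circuit** (Li–Yang §3.3, Rule 4 and
Lemma 3.11): in a pre-normalized fair semicircuit computing `f|_R` (`f` an affine disperser for
dimension `d`, `dim R ≥ 2d + 1`) with a packing, a useless gate `G` is not the output
(`out_ne_gate_of_useless`), so eliminating it and rewiring the nodes feeding it to feed its
reader gives a fair semicircuit computing `f|_R` with a packing, one gate fewer and
`Δμ ≥ 1 − 2α_φ`. [cite: LiYang2022, §3.3 (Rule 4), Lemma 3.11] -/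
theorem simplify_of_useless (hf : IsAffineDisperser f d) (hd : 2 * d + 1 ≤ R.dim) (hF : C.Fair)
    (hC : C.ComputesRestr f R) (hP : C.IsPacking P) (hφ : 0 ≤ αφ) (hI : 0 ≤ αI) (αQ : ℝ)
    (hN : C.PreNormalized) {G : Fin C.m} (hG : C.Useless G) :
    ∃ (C' : Semicircuit n) (P' : Finset (Fin C'.m × Fin C'.m)), C'.Fair ∧ C'.ComputesRestr f R ∧
      C'.IsPacking P' ∧ C'.m + 1 = C.m ∧
      C'.measure αφ αI αQ P' R ≤ C.measure αφ αI αQ P R - (1 - 2 * αφ) := by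
  have hout := out_ne_gate_of_useless hf hd hF hC hN hG
  obtain ⟨h1, Q, aQ, aG, hGQ, hQG, hshare⟩ := hG
  exact rule4 hF hC hP hφ hI αQ hGQ hQG hshare h1 hout

/-- **Normalization lemma, all five rules** (Li–Yang §3.3 "A circuit is called normalized if no
normalization rule can apply to it", Lemma 3.11, and "Note that `α_φ` will be chosen to be
smaller than `1/2`, so that `Δμ ≥ 0`. Since normalization will decrease the complexity measure,
it will not bother us to assume that the circuit is normalized during gate elimination
procedure"; Case 0 of the proof of Thm. 4.1): for `0 ≤ α_φ ≤ 1/2` and `0 ≤ α_I`, every fair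
semicircuit computing `f|_R` (`f` an affine disperser for dimension `d`, `dim R ≥ 2d + 2`) with a
packing can be replaced by a normalized fair semicircuit computing `f|_R` with a packing, with
no more gates and no larger measure. [cite: LiYang2022, §3.3, Lemma 3.11, §4.1 (Case 0.1)] -/
theorem exists_normalized (hf : IsAffineDisperser f d) (hd : 2 * d + 2 ≤ R.dim) (hφ : 0 ≤ αφ)
    (hφ' : αφ ≤ 1 / 2) (hI : 0 ≤ αI) (αQ : ℝ) :
    ∀ (m : ℕ) (D : Semicircuit n) (P : Finset (Fin D.m × Fin D.m)), D.m ≤ m → D.Fair → D.ComputesRestr f R →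
      D.IsPacking P →
      ∃ (D' : Semicircuit n) (P' : Finset (Fin D'.m × Fin D'.m)), D'.Normalized ∧ D'.Fair ∧
        D'.ComputesRestr f R ∧ D'.IsPacking P' ∧ D'.m ≤ D.m ∧
        D'.measure αφ αI αQ P' R ≤ D.measure αφ αI αQ P R := by
  intro m
  induction m with
  | zero =>
    intro D P hm hF hC hP
    refine ⟨D, P, ⟨⟨fun k => ?_, fun k => ?_, fun k => ?_⟩, fun k => ?_⟩, hF, hC, hP, le_rfl, le_rfl⟩
    all_goals exact absurd k.pos (by omega)
  | succ m ih =>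
    intro D P hm hF hC hP
    -- Rules 1, 2/3, 5 first
    obtain ⟨D₁, P₁, hN₁, hF₁, hC₁, hP₁, hm₁, hμ₁⟩ := exists_preNormalized hf hd hφ hφ' hI αQ D.m D P le_rfl hF hC hP
    by_cases hU : ∃ G, D₁.Useless G
    · -- Rule 4, then the induction hypothesis
      obtain ⟨G, hG⟩ := hU
      obtain ⟨D₂, P₂, hF₂, hC₂, hP₂, hm₂, hμ₂⟩ := simplify_of_useless hf (by omega) hF₁ hC₁ hP₁ hφ hI αQ hN₁ hG
      obtain ⟨D', P', hN', hF', hC', hP', hm', hμ'⟩ := ih D₂ P₂ (by omega) hF₂ hC₂ hP₂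
      exact ⟨D', P', hN', hF', hC', hP', by omega, by linarith⟩
    · exact ⟨D₁, P₁, ⟨hN₁, fun G hG => hU ⟨G, hG⟩⟩, hF₁, hC₁, hP₁, hm₁, hμ₁⟩

/-- **Case 0.1 in the form used by the one-step claim**: from the hypotheses of `LiYang2022_step`
(`0 < α_φ < 1/2`, `0 < α_I`), a fair semicircuit computing `f|_R` (`dim R > 2d + 2`) with a
packing has a normalized replacement with no more gates and no larger measure.
[cite: LiYang2022, §4.1 (Case 0.1)] -/
theorem exists_normalized' (hf : IsAffineDisperser f d) (hd : 2 * d + 2 < R.dim) (hφ : 0 < αφ)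
    (hφ' : αφ < 1 / 2) (hI : 0 < αI) (αQ : ℝ) (hF : C.Fair) (hC : C.ComputesRestr f R) (hP : C.IsPacking P) :
    ∃ (C' : Semicircuit n) (P' : Finset (Fin C'.m × Fin C'.m)), C'.Normalized ∧ C'.Fair ∧
      C'.ComputesRestr f R ∧ C'.IsPacking P' ∧ C'.m ≤ C.m ∧
      C'.measure αφ αI αQ P' R ≤ C.measure αφ αI αQ P R :=
  exists_normalized hf (by omega) hφ.le hφ'.le hI.le αQ C.m C P le_rfl hF hC hP

end Semicircuit

end Literature.Computability.Complexity
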